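import Summits.Ventures.PercRepro.C026Pinned
import Summits.Ventures.PercRepro.C026GluingN

/-!
# The pin package over any number of branches: §27.14 Corollary 1 in Lean (p6, gen 9)

mine-3's Corollary 1 of M3-PINCOMP (`proofs/MINE3-Q3-proof.md` §27.14): the package
`P(x) = [D_K(x) ≥ 0 ∧ Δ_{R→K}(x) ≥ 0]` holds for `G` as soon as it holds for every branch of `G` at
`x` as a graph on its own — by induction over the branches from the bare vertex `x`.  In the colouring
language of `C026GluingN`: for edges coloured by `ι` so that every vertex other than `a, b, c, x`
carries one colour (`IsGluing4N`), the package on every colour class (`colPart col i`) gives the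
package on `G`.

* transport along an endpoint-preserving edge bijection with the identity on vertices
  (`conn_edgeEquiv_iff`, `hScore_edgeEquiv`, `pinK_edgeEquiv`, `pinRK_edgeEquiv`,
  `pinPackage_of_edgeEquiv`): the merged graphs correspond edge by edge (`mergeInto_fst_edgeEquiv`);
* the edgeless graph has the package (`pinPackage_of_isEmpty`: every H-walk is trivial, so the score of
  a `bot` configuration is `0`, `hScore_eq_zero_of_isEmpty`);
* `IsGluing4N`, `isGluing4_colSub` (the edges of colour in `insert i s` are a 4-terminal two-coloured
  gluing), **`pinPackage_colSub`** (induction on the finset of colours) and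
  **`pinPackage_of_gluing4N`** — the corollary of record — with `pinPackage_of_gluing4Fin`.
-/

namespace PercRepro

namespace MultiGraph

section PinnedTransport

variable {V E₁ E₂ : Type*} {A : MultiGraph V E₁} {B : MultiGraph V E₂} {ε : E₁ ≃ E₂}

variable (hfst : ∀ e, B.fst (ε e) = A.fst e) (hsnd : ∀ e, B.snd (ε e) = A.snd e)

include hfst hsnd in
/-- **Connectivity corresponds** along an endpoint-preserving edge bijection, for ALL vertices (the
vertex map is the identity). -/
theorem conn_edgeEquiv_iff (ω : Config E₂) (u v : V) :
    A.Conn (pullConfig ε ω) u v ↔ B.Conn ω u v := by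
  constructor
  · exact conn_map (φ := id) hfst hsnd
  · intro h
    unfold Conn at h ⊢
    induction h with
    | refl => exact Relation.ReflTransGen.refl
    | tail _ hxy ih =>
      obtain ⟨f, hf, hend⟩ := hxy
      refine ih.tail ⟨ε.symm f, ?_, ?_⟩
      · simpa [pullConfig] using hf
      · have h1 := hfst (ε.symm f)
        have h2 := hsnd (ε.symm f)
        rw [Equiv.apply_symm_apply] at h1 h2
        rw [← h1, ← h2]
        exact hend

include hfst hsnd in
/-- `IsBot` corresponds along an endpoint-preserving edge bijection. -/
theorem isBot_edgeEquiv_iff (ω : Config E₂) (a b c : V) :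
    A.IsBot (pullConfig ε ω) a b c ↔ B.IsBot ω a b c :=
  isBot_map_iff (φ := id) hfst hsnd (fun _ _ _ _ h => h) ω

include hfst hsnd in
/-- `o1` corresponds along an endpoint-preserving edge bijection. -/
theorem hO1_edgeEquiv_iff (ω : Config E₂) (a b c : V) :
    A.HO1 (pullConfig ε ω) a b c ↔ B.HO1 ω a b c :=
  hConnAvoid_map_iff (φ := id) hfst hsnd (fun _ _ _ _ h => h) (Or.inr (Or.inl rfl))
    (supp_mark (Or.inr (Or.inr rfl))) (supp_mark (Or.inl rfl))

include hfst hsnd in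
/-- `o2` corresponds along an endpoint-preserving edge bijection. -/
theorem hO2_edgeEquiv_iff (ω : Config E₂) (a b c : V) :
    A.HO2 (pullConfig ε ω) a b c ↔ B.HO2 ω a b c :=
  hConnAvoid_map_iff (φ := id) hfst hsnd (fun _ _ _ _ h => h) (Or.inl rfl)
    (supp_mark (Or.inr (Or.inr rfl))) (supp_mark (Or.inr (Or.inl rfl)))

include hfst hsnd in
/-- `BAD` corresponds along an endpoint-preserving edge bijection. -/
theorem hBad_edgeEquiv_iff (ω : Config E₂) (a b c : V) :
    A.HBad (pullConfig ε ω) a b c ↔ B.HBad ω a b c :=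
  hConn_map_iff (φ := id) hfst hsnd (fun _ _ _ _ h => h) (supp_mark (Or.inl rfl))
    (supp_mark (Or.inr (Or.inl rfl)))

include hfst hsnd in
/-- The score corresponds along an endpoint-preserving edge bijection. -/
theorem hScore_edgeEquiv (ω : Config E₂) (a b c : V) :
    A.hScore (pullConfig ε ω) a b c = B.hScore ω a b c := by
  unfold hScore
  rw [hO1_edgeEquiv_iff hfst hsnd, hO2_edgeEquiv_iff hfst hsnd, hBad_edgeEquiv_iff hfst hsnd]

include hfst in
/-- The merged graphs correspond edge by edge (first endpoints). -/
theorem mergeInto_fst_edgeEquiv (x a : V) (e : E₁) :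
    (B.mergeInto x a).fst (ε e) = (A.mergeInto x a).fst e := by
  rw [mergeInto_fst, mergeInto_fst, hfst]

include hsnd in
/-- The merged graphs correspond edge by edge (second endpoints). -/
theorem mergeInto_snd_edgeEquiv (x a : V) (e : E₁) :
    (B.mergeInto x a).snd (ε e) = (A.mergeInto x a).snd e := by
  rw [mergeInto_snd, mergeInto_snd, hsnd]

variable [Fintype E₁] [DecidableEq E₁] [Fintype E₂] [DecidableEq E₂]

include hfst hsnd in
/-- `D_K(x)` is invariant under an endpoint-preserving edge bijection. -/
theorem pinK_edgeEquiv (a b c x : V) : A.pinK a b c x = B.pinK a b c x := by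
  unfold pinK
  rw [← (pullEquiv ε).sum_comp]
  refine Finset.sum_congr rfl fun ω _ => ?_
  rw [pullEquiv_apply, isBot_edgeEquiv_iff (mergeInto_fst_edgeEquiv hfst x a)
    (mergeInto_snd_edgeEquiv hsnd x a), conn_edgeEquiv_iff hfst hsnd,
    hScore_edgeEquiv (mergeInto_fst_edgeEquiv hfst x a) (mergeInto_snd_edgeEquiv hsnd x a)]

include hfst hsnd in
/-- `Δ_{R→K}(x)` is invariant under an endpoint-preserving edge bijection. -/
theorem pinRK_edgeEquiv (a b c x : V) : A.pinRK a b c x = B.pinRK a b c x := by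
  unfold pinRK
  rw [← (pullEquiv ε).sum_comp]
  refine Finset.sum_congr rfl fun ω _ => ?_
  rw [pullEquiv_apply, isBot_edgeEquiv_iff (mergeInto_fst_edgeEquiv hfst x a)
    (mergeInto_snd_edgeEquiv hsnd x a), conn_edgeEquiv_iff hfst hsnd,
    hScore_edgeEquiv (mergeInto_fst_edgeEquiv hfst x a) (mergeInto_snd_edgeEquiv hsnd x a)]

include hfst hsnd in
/-- **The pin package transports** along an endpoint-preserving edge bijection. -/
theorem pinPackage_of_edgeEquiv {a b c x : V} (h : A.PinPackage a b c x) : B.PinPackage a b c x := by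
  unfold PinPackage at h ⊢
  rw [← pinK_edgeEquiv hfst hsnd, ← pinRK_edgeEquiv hfst hsnd]
  exact h

end PinnedTransport

section PinnedEmpty

variable {V E' : Type*} [IsEmpty E'] {H : MultiGraph V E'}

/-- In a graph without edges every H-step is trivial. -/
theorem hAdj_eq_of_isEmpty {ω : Config E'} {c u v : V} (h : H.HAdj ω c u v) : u = v := by
  rcases h with ⟨_, _, e, _⟩ | ⟨_, e, _⟩ | ⟨_, _, hc⟩
  · exact isEmptyElim e
  · exact isEmptyElim e
  · exact Conn.eq_of_isEmpty hc

/-- In a graph without edges every avoiding H-walk is trivial. -/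
theorem hConnAvoid_eq_of_isEmpty {ω : Config E'} {c : V} {X : Set V} {u v : V}
    (h : H.HConnAvoid ω c X u v) : u = v := by
  unfold HConnAvoid at h
  induction h with
  | refl => rfl
  | tail _ hxy ih => exact ih.trans (hAdj_eq_of_isEmpty hxy.1)

/-- In a graph without edges every H-walk is trivial. -/
theorem hConn_eq_of_isEmpty {ω : Config E'} {c u v : V} (h : H.HConn ω c u v) : u = v := by
  unfold HConn at h
  induction h with
  | refl => rfl
  | tail _ hxy ih => exact ih.trans (hAdj_eq_of_isEmpty hxy)

/-- In a graph without edges the score of a `bot` configuration is `0`. -/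
theorem hScore_eq_zero_of_isEmpty {ω : Config E'} {a b c : V} (hb : H.IsBot ω a b c) :
    H.hScore ω a b c = 0 := by
  have h1 : ¬ H.HO1 ω a b c := fun h => by
    have := hConnAvoid_eq_of_isEmpty h
    subst this
    exact hb.2.1 (Conn.refl _ _ _)
  have h2 : ¬ H.HO2 ω a b c := fun h => by
    have := hConnAvoid_eq_of_isEmpty h
    subst this
    exact hb.2.2 (Conn.refl _ _ _)
  have h3 : ¬ H.HBad ω a b c := fun h => by
    have := hConn_eq_of_isEmpty h
    subst this
    exact hb.1 (Conn.refl _ _ _)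
  unfold hScore
  rw [if_neg h1, if_neg h2, if_neg h3]
  norm_num

variable (H)

/-- **A graph without edges has the pin package**: both sums vanish. -/
theorem pinPackage_of_isEmpty [Fintype E'] [DecidableEq E'] (a b c x : V) :
    H.PinPackage a b c x := by
  constructor
  · unfold pinK
    refine Finset.sum_nonneg fun ω _ => ?_
    split_ifs with h
    · exact le_of_eq (hScore_eq_zero_of_isEmpty h.1).symm
    · exact le_rfl
  · unfold pinRK
    refine Finset.sum_nonneg fun ω _ => ?_
    split_ifs with h
    · exact le_of_eq (hScore_eq_zero_of_isEmpty h.1).symm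
    · exact le_rfl

end PinnedEmpty

section PinnedN

variable {V E ι : Type*} (G : MultiGraph V E)

/-- **An `ι`-coloured 4-terminal gluing**: every vertex other than `a, b, c, x` is incident to edges of
one colour only. -/
def IsGluing4N (a b c x : V) (col : E → ι) : Prop :=
  ∀ v, v ≠ a → v ≠ b → v ≠ c → v ≠ x → ∀ e e', G.EdgeAt e v → G.EdgeAt e' v → col e = col e'

/-- `IsGluing4N` is decidable on finite types. -/
instance decidableIsGluing4N [Fintype V] [Fintype E] [DecidableEq V] [DecidableEq ι] (a b c x : V)
    (col : E → ι) : Decidable (G.IsGluing4N a b c x col) := by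
  unfold IsGluing4N EdgeAt
  infer_instance

/-- **The edges of colour in `insert i s` form a two-coloured 4-terminal gluing.** -/
theorem isGluing4_colSub [DecidableEq ι] (a b c x : V) (col : E → ι)
    (hg : G.IsGluing4N a b c x col) (i : ι) (s : Finset ι) :
    (G.colSub col (insert i s)).IsGluing4 a b c x (colSide col i s) := by
  intro v hva hvb hvc hvx e e' he he'
  have h := hg v hva hvb hvc hvx e.1 e'.1 he he'
  show decide (col e.1 = i) = decide (col e'.1 = i)
  rw [h]

/-- **The pin package on a finset of colours**: if every colour class with colour in `s` has the
package, so does the subgraph of the edges of colour in `s` (induction on `s`; the step is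
`pinPackage_of_gluing4` for «colour `i`» against «colour in `s`»). -/
theorem pinPackage_colSub [Fintype E] [DecidableEq E] [DecidableEq ι] (a b c x : V) (hab : a ≠ b)
    (hac : a ≠ c) (hbc : b ≠ c) (hxa : x ≠ a) (hxb : x ≠ b) (hxc : x ≠ c) (col : E → ι)
    (hg : G.IsGluing4N a b c x col) (s : Finset ι)
    (h : ∀ i ∈ s, (G.colPart col i).PinPackage a b c x) : (G.colSub col s).PinPackage a b c x := by
  revert h
  refine Finset.induction_on s ?_ ?_
  · intro _
    haveI : IsEmpty {e // col e ∈ (∅ : Finset ι)} := ⟨fun e => Finset.notMem_empty _ e.2⟩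
    exact pinPackage_of_isEmpty _ a b c x
  · intro i s hi ih h
    have h₁ : ((G.colSub col (insert i s)).part (colSide col i s) true).PinPackage a b c x :=
      pinPackage_of_edgeEquiv (ε := colEquivTrue col i s) (fun _ => rfl) (fun _ => rfl)
        (h i (Finset.mem_insert_self i s))
    have h₀ : ((G.colSub col (insert i s)).part (colSide col i s) false).PinPackage a b c x :=
      pinPackage_of_edgeEquiv (ε := colEquivFalse col i s hi) (fun _ => rfl) (fun _ => rfl)
        (ih fun j hj => h j (Finset.mem_insert_of_mem hj))
    exact pinPackage_of_gluing4 _ a b c x hab hac hbc hxa hxb hxc (colSide col i s)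
      (G.isGluing4_colSub a b c x col hg i s) h₁ h₀

/-- **§27.14 COROLLARY 1 — THE PIN PACKAGE OVER ANY NUMBER OF BRANCHES**: if the edges of `G` are
coloured by `ι` so that every vertex other than `a, b, c, x` carries one colour (the colour classes are
the «branches» at `x`), and every colour class has the package `P(x)`, then `G` has it — in particular
`D_K(x) ≥ 0`, the (C)-pinning inequality of §23.1. -/
theorem pinPackage_of_gluing4N [Fintype E] [DecidableEq E] [Fintype ι] [DecidableEq ι]
    (a b c x : V) (hab : a ≠ b) (hac : a ≠ c) (hbc : b ≠ c) (hxa : x ≠ a) (hxb : x ≠ b)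
    (hxc : x ≠ c) (col : E → ι) (hg : G.IsGluing4N a b c x col)
    (h : ∀ i, (G.colPart col i).PinPackage a b c x) : G.PinPackage a b c x :=
  pinPackage_of_edgeEquiv (ε := Equiv.subtypeUnivEquiv fun e => Finset.mem_univ (col e))
    (fun _ => rfl) (fun _ => rfl)
    (G.pinPackage_colSub a b c x hab hac hbc hxa hxb hxc col hg Finset.univ fun i _ => h i)

/-- **§27.14 Corollary 1 for `n` branches** (`Fin n`). -/
theorem pinPackage_of_gluing4Fin [Fintype E] [DecidableEq E] (n : ℕ) (a b c x : V) (hab : a ≠ b)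
    (hac : a ≠ c) (hbc : b ≠ c) (hxa : x ≠ a) (hxb : x ≠ b) (hxc : x ≠ c) (col : E → Fin n)
    (hg : G.IsGluing4N a b c x col) (h : ∀ i, (G.colPart col i).PinPackage a b c x) :
    G.PinPackage a b c x :=
  G.pinPackage_of_gluing4N a b c x hab hac hbc hxa hxb hxc col hg h

end PinnedN

end MultiGraph

end PercRepro
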